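import Summits.QuantumFields.YangMills.Theorems.CovariantDischargeClosureDefectBianchi
import Summits.QuantumFields.YangMills.Theorems.UnitScaleTiltProp7CovariantWeitzenbock
import Literature.MathematicalPhysics.QuantumFieldTheory.Balaban1983to89.B10Eq27TorusAxialLog
import Literature.MathematicalPhysics.QuantumFieldTheory.Balaban1983to89.B8Ineq170
import HarnessLib

/-!
# `UnitScaleGibbsChartPullbackBianchi` — THE CHART PULLBACK OF A TORUS GAUGE FIELD TO `ℤ^d` AND ITS DRESSED BIANCHI BOUND ON A SMALL BOX
# (KNIT-A∕C of the `stub_linTest` v3.1 plan; LINE 28 «GrossTransfer», crux `UnitScaleTilt.HistoryTailL` stmt-QuantumFields-19936 ∕ `MeanDeviationL` stmt-QuantumFields-23083)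

Cell `ym3-torus` (YM ladder rung R3 = continuum SU(2) Yang–Mills on T³ — a RUNG, NOT the Clay problem: not d = 4, not infinite volume, not a mass gap),
width seat `ym-ust-19936-w2` (gen 15), pen of record of `stub_linTest`.  KNIT-PLAN (23083 evidence #9) row P6: the Bianchi term `⟨χγ̃, d₂F̂⟩` of the
cutoff-potential identity needs `|d₂F̂| ≲ η²` for the READ dressed curvature `F̂(y,μ,ν) = λ(V̂(∂p_{μν}(y)) − 1)` of the chart pullback
`V̂(y,κ) = (VU)⟨transl c y, κ⟩` ONLY ON THE BOX where the event makes bonds `η`-small; ✓(r3) `CovariantDischargeClosureDefectBianchi.dTwo_read_plaqF_le_on_box`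
asks the plaquette bound `a ≤ 1` GLOBALLY on `ℤ^d`.  THIS FILE bridges: §1 `hol` of a pullback along the chart IS the torus plaquette variable
(`hol_pullback_plaqWord`); §2 for `U1`-valued fields the plaquette deviation is at most the sum of the four bond deviations (`norm_plaqF_sub_one_le_of_bonds`, from ✓`B8Ineq170.norm_mul_sub_one_le_of_norm_le_one` ∕ ✓`B7Prop1Explicit.norm_inv_sub_one_le`);
§3 the LOCALISED field `V′ = V̂` on the bonds based in `Q_S`, `= 1` elsewhere, is globally `η`-small on bonds and `4η`-small on plaquettes, and its read
curvature has the same `d₂` as `V̂`'s at the sites of `Q_{S−2}` (`plaqF_localise_eq`); whence ★★`abs_dTwo_read_pullback_le_on_box`: for `4η ≤ 1`,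
`|d₂F̂(y,κ,μ,ν)| ≤ ‖λ‖·984·η²` on `Q_{S−2}` from bond smallness `‖V̂ − 1‖ ≤ η` on `Q_S` alone.
HONEST FRAMING.  Bookkeeping over landed identities; `--supports` helper; proves no stub, crux, rung or summit statement; `stub_linTest`, «ShallowFluxSecondMomentL»,
(Q), K1, `MeanDeviationL`, `HistoryTailL` are NOT proved; the Yang–Mills mass gap is NOT proved.
References: [Balaban1985Averaging] (9), (19) pp. 18–21; [Balaban1985RegularSpaces] (1.2) p. 76; [GrossCMP1983] Thm 2.2.
-/

noncomputable section

set_option autoImplicit false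

open scoped BigOperators Matrix.Norms.L2Operator
open Finset
open Literature.MathematicalPhysics.QuantumFieldTheory.Balaban1983to89
open Literature.MathematicalPhysics.QuantumFieldTheory.Balaban1983to89.B4Eq19LatticeOperators (Zd unitVec box mem_box box_mono add_unitVec_mem_box)
open B7Prop1Explicit (Site e hol plaqWord U1)
open B8Ineq132 (plaqF)
open B10Eq27TorusAxialLog (transl transl_add_e)
open Summit.QuantumFields.YangMills.Theorems.CovariantDischargeClosureDefectBianchi (dTwo_read_plaqF_le_everywhere e_eq_unitVec)

namespace Summit.QuantumFields.YangMills.Theorems.UnitScaleGibbsChartPullbackBianchi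

/-! ## §1 The plaquette holonomy of a chart pullback is the torus plaquette variable -/

section Pullback

variable {P : Params} {j : ℕ} {G : Type*} [Group G]

/-- ★ For `V̂(y,κ) = W⟨transl c y, κ⟩`: `hol V̂ y (plaqWord μ ν) = W(∂p)` for the torus plaquette `p = ⟨transl c y, μ, ν⟩` (`transl c (y + e_μ) = (transl c y).shift μ`).
[cite: Balaban1985Averaging, (9) p.18] -/
theorem hol_pullback_plaqWord (W : PBond P j → G) (c : Site P j) (Vh : Site P.d → Fin P.d → G) (hVh : ∀ y κ, Vh y κ = W ⟨transl c y, κ⟩)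
    (y : Site P.d) (μ ν : Fin P.d) :
    hol Vh y (plaqWord μ ν) = W ⟨transl c y, μ⟩ * W ⟨(transl c y).shift μ, ν⟩ * (W ⟨(transl c y).shift ν, μ⟩)⁻¹ * (W ⟨transl c y, ν⟩)⁻¹ := by
  rw [CurvGradAxial.hol_plaqWord_eq, hVh, hVh, hVh, hVh, transl_add_e, transl_add_e]

end Pullback

/-! ## §2 `U1`-valued fields: plaquette deviation from bond deviations -/

section UOne

variable {𝔸 : Type*} [NormedRing 𝔸] [NormOneClass 𝔸] {d : ℕ}

/-- ★ **PLAQUETTE DEVIATION FROM BOND DEVIATIONS** (`U1`-valued): `‖V(∂p_{κμ}(y)) − 1‖ ≤ ‖V(y,κ)−1‖ + ‖V(y+e_κ,μ)−1‖ + ‖V(y+e_μ,κ)−1‖ + ‖V(y,μ)−1‖`.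
[cite: Balaban1985Averaging, (19)–(20) p.21] -/
theorem norm_plaqF_sub_one_le_of_bonds (V : Site d → Fin d → 𝔸ˣ) (hV : ∀ x κ, V x κ ∈ U1 𝔸) (κ μ : Fin d) (y : Site d) :
    ‖plaqF V κ μ y - 1‖ ≤ ‖(V y κ : 𝔸) - 1‖ + ‖(V (y + e κ) μ : 𝔸) - 1‖ + ‖(V (y + e μ) κ : 𝔸) - 1‖ + ‖(V y μ : 𝔸) - 1‖ := by
  unfold plaqF
  rw [CurvGradAxial.hol_plaqWord_eq]
  push_cast
  have h1 : ‖(V y κ : 𝔸)‖ ≤ 1 := (hV y κ).1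
  have h2 : ‖(V (y + e κ) μ : 𝔸)‖ ≤ 1 := (hV _ μ).1
  have h3 : ‖(((V (y + e μ) κ)⁻¹ : 𝔸ˣ) : 𝔸)‖ ≤ 1 := (hV _ κ).2
  have h12 : ‖(V y κ : 𝔸) * (V (y + e κ) μ : 𝔸)‖ ≤ 1 := (norm_mul_le _ _).trans (by nlinarith [norm_nonneg (V y κ : 𝔸), norm_nonneg (V (y + e κ) μ : 𝔸)])
  have h123 : ‖(V y κ : 𝔸) * (V (y + e κ) μ : 𝔸) * (((V (y + e μ) κ)⁻¹ : 𝔸ˣ) : 𝔸)‖ ≤ 1 :=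
    (norm_mul_le _ _).trans (by nlinarith [norm_nonneg ((V y κ : 𝔸) * (V (y + e κ) μ : 𝔸)), norm_nonneg (((V (y + e μ) κ)⁻¹ : 𝔸ˣ) : 𝔸)])
  calc ‖(V y κ : 𝔸) * (V (y + e κ) μ : 𝔸) * (((V (y + e μ) κ)⁻¹ : 𝔸ˣ) : 𝔸) * (((V y μ)⁻¹ : 𝔸ˣ) : 𝔸) - 1‖
      ≤ ‖(V y κ : 𝔸) * (V (y + e κ) μ : 𝔸) * (((V (y + e μ) κ)⁻¹ : 𝔸ˣ) : 𝔸) - 1‖ + ‖(((V y μ)⁻¹ : 𝔸ˣ) : 𝔸) - 1‖ := B8Ineq170.norm_mul_sub_one_le_of_norm_le_one h123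
    _ ≤ (‖(V y κ : 𝔸) * (V (y + e κ) μ : 𝔸) - 1‖ + ‖(((V (y + e μ) κ)⁻¹ : 𝔸ˣ) : 𝔸) - 1‖) + ‖(((V y μ)⁻¹ : 𝔸ˣ) : 𝔸) - 1‖ := by
        gcongr; exact B8Ineq170.norm_mul_sub_one_le_of_norm_le_one h12
    _ ≤ ((‖(V y κ : 𝔸) - 1‖ + ‖(V (y + e κ) μ : 𝔸) - 1‖) + ‖(V (y + e μ) κ : 𝔸) - 1‖) + ‖(V y μ : 𝔸) - 1‖ := by
        gcongr
        · exact B8Ineq170.norm_mul_sub_one_le_of_norm_le_one h1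
        · exact B7Prop1Explicit.norm_inv_sub_one_le (hV _ κ)
        · exact B7Prop1Explicit.norm_inv_sub_one_le (hV y μ)
    _ = _ := by ring

end UOne

/-! ## §3 Localisation and the Bianchi bound on a box -/

section Localise

variable {𝔸 : Type*} [NormedRing 𝔸] [NormOneClass 𝔸] [NormedAlgebra ℝ 𝔸] {d : ℕ}

omit [NormOneClass 𝔸] [NormedAlgebra ℝ 𝔸] in
/-- The plaquette field at `y` in directions `κ, μ` depends only on the bonds at `y`, `y + e_κ`, `y + e_μ`. [cite: Balaban1985Averaging, (9) p.18] -/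
theorem plaqF_congr (V V' : Site d → Fin d → 𝔸ˣ) (y : Site d) (κ μ : Fin d)
    (h0 : ∀ ν, V' y ν = V y ν) (hκ : ∀ ν, V' (y + e κ) ν = V (y + e κ) ν) (hμ : ∀ ν, V' (y + e μ) ν = V (y + e μ) ν) :
    plaqF V' κ μ y = plaqF V κ μ y := by
  unfold plaqF
  rw [CurvGradAxial.hol_plaqWord_eq, CurvGradAxial.hol_plaqWord_eq, h0, hκ, hμ, h0]

/-- ★★ **THE DRESSED BIANCHI BOUND ON A BOX FROM BOND SMALLNESS ALONE.**  Let `V : Site d → Fin d → 𝔸ˣ` be `U1`-valued with `‖V(y,κ) − 1‖ ≤ η` for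
`y ∈ Q_S(z)`, `0 ≤ η`, `4η ≤ 1`, and `F(y,μ,ν) = λ(V(∂p_{μν}(y)) − 1)` with `dF` its alternating cube derivative ((Z-a) letter).  Then for every
`y ∈ Q_{S−2}(z)` and all `κ μ ν`: `|dF(y,κ,μ,ν)| ≤ ‖λ‖·(984·η²)` (✓`dTwo_read_plaqF_le_everywhere` applied to the localised field `V′ := V` on `Q_S`,
`1` elsewhere, which is `η`-small on every bond and `4η`-small on every plaquette of `ℤ^d`; `60·(4η)² + 6·η·(4η) = 984η²`). [cite: GrossCMP1983, Thm 2.2] -/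
theorem abs_dTwo_read_le_on_box (V : Site d → Fin d → 𝔸ˣ) (hV : ∀ x κ, V x κ ∈ U1 𝔸) (z : Site d) (S : ℤ) {η : ℝ} (hη : 0 ≤ η) (hη4 : 4 * η ≤ 1)
    (hsmall : ∀ y ∈ box z S, ∀ κ, ‖(V y κ : 𝔸) - 1‖ ≤ η) (lam : 𝔸 →L[ℝ] ℝ) (F : Site d → Fin d → Fin d → ℝ)
    (hF : ∀ x μ ν, F x μ ν = lam (plaqF V μ ν x - 1)) (dF : Site d → Fin d → Fin d → Fin d → ℝ)
    (hdF : ∀ x κ μ ν, dF x κ μ ν = (F (x + unitVec κ) μ ν - F x μ ν) - (F (x + unitVec μ) κ ν - F x κ ν) + (F (x + unitVec ν) κ μ - F x κ μ)) :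
    ∀ y ∈ box z (S - 2), ∀ κ μ ν, |dF y κ μ ν| ≤ ‖lam‖ * (984 * η ^ 2) := by
  classical
  -- the localised field
  set V' : Site d → Fin d → 𝔸ˣ := fun x κ => if x ∈ box z S then V x κ else 1 with hV'
  have hV'1 : ∀ x κ, V' x κ ∈ U1 𝔸 := fun x κ => by
    by_cases hx : x ∈ box z S
    · simp only [hV', hx, ↓reduceIte]; exact hV x κ
    · simp only [hV', hx, ↓reduceIte]; exact one_mem _
  have hV'small : ∀ x κ, ‖(V' x κ : 𝔸) - 1‖ ≤ η := fun x κ => by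
    by_cases hx : x ∈ box z S
    · simp only [hV', hx, ↓reduceIte]; exact hsmall x hx κ
    · simp only [hV', hx, ↓reduceIte, Units.val_one, sub_self, norm_zero]; exact hη
  have hV'plaq : ∀ (x : Site d) (κ μ : Fin d), κ ≠ μ → ‖plaqF V' κ μ x - 1‖ ≤ 4 * η := fun x κ μ _ => by
    have h := norm_plaqF_sub_one_le_of_bonds V' hV'1 κ μ x
    linarith [hV'small x κ, hV'small (x + e κ) μ, hV'small (x + e μ) κ, hV'small x μ]
  -- the read field of `V'` and its cube derivative
  set F' : Site d → Fin d → Fin d → ℝ := fun x μ ν => lam (plaqF V' μ ν x - 1) with hF'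
  set dF' : Site d → Fin d → Fin d → Fin d → ℝ := fun x κ μ ν =>
    (F' (x + unitVec κ) μ ν - F' x μ ν) - (F' (x + unitVec μ) κ ν - F' x κ ν) + (F' (x + unitVec ν) κ μ - F' x κ μ) with hdF'
  have hB := dTwo_read_plaqF_le_everywhere V' hV'1 (a := 4 * η) (β := η) (by positivity) hη4 hη hV'plaq lam F' (fun _ _ _ => rfl) dF'
    (fun _ _ _ _ => rfl) hV'small
  -- on `Q_{S−2}` the two read fields have the same cube derivative
  intro y hy κ μ ν
  have hmem : ∀ w : Site d, (∀ i, |w i - y i| ≤ 2) → w ∈ box z S := fun w hw => by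
    rw [mem_box] at hy ⊢
    intro i
    have h1 := hy i
    have h2 := hw i
    have : w i - z i = (w i - y i) + (y i - z i) := by ring
    rw [this]
    exact (abs_add_le _ _).trans (by linarith)
  have habs_e : ∀ (ι i : Fin d), |(e ι : Site d) i| ≤ 1 := fun ι i => by
    rw [e_eq_unitVec]; exact B4Eq19LatticeOperators.abs_unitVec_apply_le ι i
  -- every site `y + e_ι (+ e_ι')` used below is within sup-distance 2 of `y`
  have hnear0 : y ∈ box z S := hmem y fun i => by simp
  have hnear1 : ∀ ι : Fin d, y + e ι ∈ box z S := fun ι => hmem _ fun i => by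
    simp only [Pi.add_apply, add_sub_cancel_left]; exact (habs_e ι i).trans (by norm_num)
  have hnear2 : ∀ ι ι' : Fin d, y + e ι + e ι' ∈ box z S := fun ι ι' => hmem _ fun i => by
    simp only [Pi.add_apply, show y i + (e ι : Site d) i + (e ι' : Site d) i - y i = (e ι : Site d) i + (e ι' : Site d) i by ring]
    exact (abs_add_le _ _).trans (by linarith [habs_e ι i, habs_e ι' i])
  have hVeq : ∀ w : Site d, w ∈ box z S → ∀ ν', V' w ν' = V w ν' := fun w hw ν' => by simp only [hV', hw, ↓reduceIte]
  have hplaq0 : ∀ κ' μ' : Fin d, plaqF V' κ' μ' y = plaqF V κ' μ' y := fun κ' μ' =>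
    plaqF_congr V V' y κ' μ' (hVeq y hnear0) (hVeq _ (hnear1 κ')) (hVeq _ (hnear1 μ'))
  have hplaq1 : ∀ ι κ' μ' : Fin d, plaqF V' κ' μ' (y + e ι) = plaqF V κ' μ' (y + e ι) := fun ι κ' μ' =>
    plaqF_congr V V' (y + e ι) κ' μ' (hVeq _ (hnear1 ι)) (hVeq _ (hnear2 ι κ')) (hVeq _ (hnear2 ι μ'))
  have hFF : ∀ κ' μ' : Fin d, F' y κ' μ' = F y κ' μ' := fun κ' μ' => by rw [hF]; simp only [hF', hplaq0]
  have hFF1 : ∀ ι κ' μ' : Fin d, F' (y + unitVec ι) κ' μ' = F (y + unitVec ι) κ' μ' := fun ι κ' μ' => by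
    rw [hF, ← e_eq_unitVec]; simp only [hF', hplaq1]
  have key : dF y κ μ ν = dF' y κ μ ν := by
    rw [hdF]; simp only [hdF', hFF, hFF1]
  rw [key]
  refine (hB y κ μ ν).trans (le_of_eq ?_)
  ring

end Localise

/-! ## §4 The `SU(N)` instance: units of the matrix algebra, bond deviation = `dist₁` -/

section SpecialUnitary

variable {N : ℕ} [NeZero N] {P : Params} {j : ℕ}

/-- A unit of `M_N(ℂ)` whose value is a special unitary matrix lies in `U1`. [cite: Balaban1985Averaging, (19) p.21] -/
theorem mem_U1_of_val_eq_coe (u : (Matrix (Fin N) (Fin N) ℂ)ˣ) (g : Matrix.specialUnitaryGroup (Fin N) ℂ)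
    (hu : (u : Matrix (Fin N) (Fin N) ℂ) = (g : Matrix (Fin N) (Fin N) ℂ)) : u ∈ U1 (Matrix (Fin N) (Fin N) ℂ) :=
  Prop7CovariantCoercivity.mem_U1_of_unitary (by rw [hu]; exact g.2.1)

/-- The bond deviation of the pullback is the torus `dist₁`: `‖↑(W b) − 1‖ = dist₁(W b)`. [cite: Balaban1985Averaging, (19) p.21] -/
theorem norm_coe_sub_one_eq_dist1 (g : Matrix.specialUnitaryGroup (Fin N) ℂ) :
    ‖(g : Matrix (Fin N) (Fin N) ℂ) - 1‖ = GaugeGroup.dist1 g := (FederbushMean.dist1_SU_eq g).symm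

end SpecialUnitary

end Summit.QuantumFields.YangMills.Theorems.UnitScaleGibbsChartPullbackBianchi

end
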